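import Summits.QuantumFields.YangMills.Theorems.BalabanUVNodesN19RekeyingAbsorption
import Summits.QuantumFields.YangMills.Theorems.BalabanUVNodesN19NoDialRescuesLawSeparated

/-!
# BalabanUVNodes ∕ node N19 (NE7) — ONE DATUM, TWO KEYS: at the FULL (old × young) key a law-separated two-run pair is DEAD UNDER EVERY DIAL (dag-n19-w4's `no_dial_rescues`),
# at the WINDOW (young) key the SAME pair is ALIVE WITH NO DIAL AT ALL (this seat's descent with absorption) — the law-merge mechanism's A2 inhabitant; plus the causal form of
# the decoupling letter (old law × forward kernel, kernel LR-close to an old-independent one ⇒ the absorption hypothesis) and the necessity of its summability in the caricature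

Cell `pub-ymgap` (HUMAN RULING D-0062 Track A ∕ D-0149 width seats), WIDTH SEAT `pub-ymgap-dag-n19-w1` (node n19 = NE7, seat 1 of 3), generation g4, INTENT-2.  Route
`Summits/QuantumFields/YangMills/Theses/BalabanUVNodes.lean`, key item K3⁷ `SpineGivenEndpointR13SepCoPH` (stmt-QuantumFields-20544; v5 stub 2 `stub_expansion13H`: its N19′ ∧ N20 ∧ N21
conjuncts = the face triple `Core ∧ RelWeightBound ∧ ShellWeightBound` at ONE pinned key); filed `--kind proof --supports … --as helper`.  COUNT-NEUTRAL.  THEOREMS ONLY (0 `def`,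
0 `sorry`).  ADDITIVE — imports this seat's g4 `…Theorems.BalabanUVNodesN19RekeyingAbsorption` (p610409: `core_fibreSum_of_factorisation`, `hybridNE7_fibreSum_of_factorisation`; through
it g3 `…N19HybridBeyondTarget.not_coreEdge_of_unsummable_gap`, the tree's `Spine/NE7/Targets` (`Core`), `T4MatchingAssembly` (`HybridNE7`), `T4WeightBudget` (`RelWeightBound`),
`T4IndicatorShell` (`ShellWeightBound`)) and dag-n19-w4 g3's `…Theorems.BalabanUVNodesN19NoDialRescuesLawSeparated` (p608854: `no_dial_rescues`); modifies nothing.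

WHY.  Plan g83 WORDS-4 (INBOX l.29644) books K3⁷'s bookings (1) `kr := wkey` and (7) `no_dial_rescues` modulo (LS) as «ONE future v6 move: re-key the core law at the window key»,
to be cut when law separation (LS) at the record is typed or a consumer names the window key.  The two kernel facts behind that sentence now both exist BY NAME — dag-n19-w4's
`no_dial_rescues` (at FIXED carriers a law-separated pair admits NO `Bad ∕ W ∕ shA ∕ shB ∕ Wsh ∕ δ` with the face triple) and this seat's `core_fibreSum_of_factorisation` (at a
COARSER key an arbitrary old discrepancy is absorbed into `c_K` once each run LR-factorises) — but no datum in the tree exhibits BOTH AT ONCE.  A6 ∕ A2 hygiene asks for one: is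
«(LS) at the full key» compatible with «law merge at the window key» on the same pair of runs, or does the first secretly obstruct the second?  THIS FILE answers with the
smallest honest datum and, on the way, puts the decoupling letter (D) of p610409's header in its CAUSAL form.
THE DATUM (level `K`; letters `κ_K > 0` young activity, `u_K ≥ 0` young two-run discrepancy, `0 ≤ η_K ≤ 1` old→young LR-coupling; old discrepancy factor `3`): index
`(y, o) ∈ Bool × Bool` (young block large-field?, old block large-field?); run A `p(y,o) = k̄(y)·(1 + η_K·[y ∧ o])` with `k̄(false) = 1`, `k̄(true) = κ_K` (old law uniform = SATURATED:
half of run A's mass carries an old large field); run B `q(y,o) = b(o)·k̄′(y)·(1 + η_K·[y ∧ o])` with `b(false) = 1`, `b(true) = 3` (an O(1), non-summable two-run mismatch on the old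
block), `k̄′(false) = 1`, `k̄′(true) = κ_K·e^{u_K}`.
* §1 [folklore] THE CAUSAL FORM OF (D): ★ `factorisation_of_forwardKernel` — a run given as (old law `a K o ≥ 0`) × (forward kernel `k K t o τ` from old to young∕class) whose kernel is
  LR-close, `e^{±σ_K}`, to an old-INDEPENDENT law `k̄ K t τ` factorises as p610409 §3 asks (class factor `k̄`, profile `a`, LR error `σ`); ★★ `core_fibreSum_of_forwardKernels` — two such
  runs with `Core … k̄_A k̄_B r` ⇒ `Core … (Σ_o p) (Σ_o q) (r + (σ_A + σ_B)∕vol)` at the young key, the old laws `a`, `b` ARBITRARY.  (D) = «the window structure's conditional law given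
  the old structure depends on the old structure only up to a likelihood ratio `e^{±σ_K}`» — the shape an RG contraction is expected to deliver for healed regions; ONE-RUN letters.
* §2 [folklore] THE DATUM AT THE FULL KEY — DEAD UNDER EVERY DIAL: `sum_full_p` ∕ `sum_full_q` ∕ `sum_old_p` ∕ `sum_old_q` (closed forms) · ★ `lawSeparated_full` (the old-block class
  `S = {o = true}` has run-A law `≤ 2∕3` and run-B law `≥ 3∕4`: separation `s = 1∕12` at EVERY level and source) · ★★ `full_key_no_dial` (`no_dial_rescues` BY NAME: for every `l₀ ≥ 0`,
  `vol`, NO `Bad, W, shA, shB, Wsh, δ` give `RelWeightBound ∧ ShellWeightBound ∧ (Core (p − shA) (q − shB) δ ∧ Summable δ)` on `T K = Bool × Bool`).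
* §3 [folklore] THE SAME DATUM AT THE WINDOW KEY — ALIVE WITH NO DIAL: `fac_window_p` ∕ `fac_window_q` (§1's factorisation with `σ = log(1 + η_K)`) · `core_youngFactors` (`k̄`, `k̄′` match
  at radius `u_K`) · ★★★ `window_key_core` (`Core l₀ vol {false,true} ∅ (Σ_o p) (Σ_o q) (K ↦ (u_K + 2·log(1 + η_K))∕vol)` — p610409 §3 BY NAME; the factor `3` sits in `c_K`) ·
  `summable_windowRadius` (`u`, `η` summable ⇒ the radius is) · ★★ `window_key_hybridNE7` (the full binder list `HybridNE7 … ∅ 0 0 0 0 δ` at the window key: zero bad class, zero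
  shells — no dial used).
* §4 [folklore] NECESSITY OF (D)'s SUMMABILITY IN THE CARICATURE: `window_gap_ge` (the window-key class gap is `≥ η_K ∕ 7` whatever `u_K ≥ 0`) · ★★ `window_key_needs_summable_coupling`
  (`η ≥ 0` NOT summable ⇒ NO summable `Core` at the window key either — g3's `not_coreEdge_of_unsummable_gap` BY NAME): at the window key the one thing to pay is the old→young
  LR-coupling, and it must be paid summably.
READINGS (located; nothing proposed).  (i) (LS) at the full key and law merge at the window key COEXIST on one pair of runs: booking (7)'s letter, if ever typed at the record, kills
stub 2 AS KEYED (v5 pin = full σ-packed histories) and says NOTHING against booking (1)'s re-keyed stub — the two bookings are indeed one move, and the move is not obstructed by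
(LS).  (ii) What the window key charges instead is (D): per-block LR-coupling `η_K` (here one block) of the young structure's law to the old structure, summably in `K` — §4 shows the
charge is real.  (iii) Saturation of the old class (half the mass, both runs) is harmless at the window key and fatal at the full key — the dial `jc` cannot cut a saturated class
(n20-w1's policy wall), the key can forget it.  (iv) Nothing here is Bałaban's: whether the 𝐑-operation ∕ history rewriting delivers (D) for d = 4 is unprinted and unproved.

HONEST FRAMING.  One explicit finite datum + [folklore] finite-sum ∕ real arithmetic over the tree's SHAPES (`Core`, `RelWeightBound`, `ShellWeightBound`, `HybridNE7`); the letters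
`κ, u, η` are free sequences; nothing of Bałaban's is asserted or instantiated; no estimate of the programme is proved.  NE7 ∕ NE7b ∕ NE7c NOT PRINTED as two-run statements for d = 4 ∕
NOT proved; N19 ∕ N20 ∕ N21 NOT discharged; K3⁷ OPEN, not claimed, v5 untouched; counts UNMOVED (typed 28∕28 · discharged 5∕27, A 5∕28).  Everything below is PROVED (0 `sorry`, 0 named
facts, standard axioms); no decl carries a cite tag.  One finite four-torus programme at fixed ε — NOT ℝ⁴, NOT infinite volume, NOT OS, NOT a mass gap, NOT the Clay problem (R4 closes
the conditional finite-𝕋⁴ rung `BalabanLadder.UV` only).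
-/

noncomputable section

open Finset
open scoped BigOperators
namespace Summit.QuantumFields.YangMills.BalabanUVNodes.N19OneDatumTwoKeys

open Summit.QuantumFields.BalabanUV.T4Continuum.Spine.NE7 (Core)
open Literature.MathematicalPhysics.QuantumFieldTheory.Balaban1983to89
open T4WeightBudget (RelWeightBound)
open T4IndicatorShell (ShellWeightBound)
open T4MatchingAssembly (HybridNE7)
open Summit.QuantumFields.YangMills.BalabanUVNodes.N19RekeyingAbsorption (core_fibreSum_of_factorisation hybridNE7_fibreSum_of_factorisation)
open Summit.QuantumFields.YangMills.BalabanUVNodes.N19HybridBeyondTarget (not_coreEdge_of_unsummable_gap)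
open Summit.QuantumFields.YangMills.BalabanUVNodes.N19NoDialRescuesLawSeparated (no_dial_rescues)

/-! ## §1 The causal form of the decoupling letter: old law × forward kernel [folklore] -/

section Kernel
variable {ι ω : Type*} [DecidableEq ι] {l₀ vol : ℝ} {T : ℕ → Finset ι} {O : ℕ → Finset ω} {Bad : ℕ → ℝ → Finset ι}
  {a b : ℕ → ω → ℝ} {kA kB : ℕ → ℝ → ω → ι → ℝ} {kbarA kbarB : ℕ → ℝ → ι → ℝ} {σA σB r : ℕ → ℝ}

omit [DecidableEq ι] in
/-- **★ FORWARD KERNEL ⇒ FACTORISATION** [folklore].  A run presented CAUSALLY — old structure `o` drawn with weight `a K o ≥ 0`, then the young∕class structure `τ` with a forward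
kernel `k K t o τ` — whose kernel depends on the old structure only up to a likelihood ratio, `e^{−σ_K}·k̄ K t τ ≤ k K t o τ ≤ e^{σ_K}·k̄ K t τ` for an old-INDEPENDENT `k̄`, satisfies
p610409 §3's factorisation hypothesis with class factor `k̄`, profile `a` and LR error `σ`. -/
theorem factorisation_of_forwardKernel {k : ℕ → ℝ → ω → ι → ℝ} {kbar : ℕ → ℝ → ι → ℝ} {a : ℕ → ω → ℝ} {σ : ℕ → ℝ}
    (ha : ∀ K, ∀ o ∈ O K, 0 ≤ a K o)
    (hk : ∀ (K : ℕ) (t : ℝ), |t| ≤ l₀ → ∀ τ ∈ T K, ∀ o ∈ O K,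
      Real.exp (-σ K) * kbar K t τ ≤ k K t o τ ∧ k K t o τ ≤ Real.exp (σ K) * kbar K t τ) :
    ∀ (K : ℕ) (t : ℝ), |t| ≤ l₀ → ∀ τ ∈ T K, ∀ o ∈ O K,
      Real.exp (-σ K) * (kbar K t τ * a K o) ≤ a K o * k K t o τ ∧ a K o * k K t o τ ≤ Real.exp (σ K) * (kbar K t τ * a K o) := by
  intro K t ht τ hτ o ho
  obtain ⟨h1, h2⟩ := hk K t ht τ hτ o ho
  have ha0 := ha K o ho
  constructor
  · calc Real.exp (-σ K) * (kbar K t τ * a K o) = a K o * (Real.exp (-σ K) * kbar K t τ) := by ring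
      _ ≤ a K o * k K t o τ := mul_le_mul_of_nonneg_left h1 ha0
  · calc a K o * k K t o τ ≤ a K o * (Real.exp (σ K) * kbar K t τ) := mul_le_mul_of_nonneg_left h2 ha0
      _ = Real.exp (σ K) * (kbar K t τ * a K o) := by ring

/-- **★★ TWO CAUSAL RUNS MERGE AT THE YOUNG KEY** [folklore].  Run A = old law `a` × forward kernel `k_A`, run B = old law `b` × forward kernel `k_B`, each kernel within `e^{±σ}` of an
old-independent young law (`k̄_A`, `k̄_B`), the young laws matched modulo constants (`Core … k̄_A k̄_B r`), `k̄_A ≥ 0`, `b ≥ 0`, both old laws of positive mass ⇒ the sums over the old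
structure match modulo constants at radius `r + (σ_A + σ_B)∕vol`.  The OLD LAWS `a`, `b` — and so the old two-run discrepancy `b∕a` — are otherwise ARBITRARY: saturated, mismatched by
O(1) per block, anything (p610409 `core_fibreSum_of_factorisation` BY NAME). -/
theorem core_fibreSum_of_forwardKernels (hvol : 0 < vol)
    (ha : ∀ K, ∀ o ∈ O K, 0 ≤ a K o) (hb : ∀ K, ∀ o ∈ O K, 0 ≤ b K o)
    (hapos : ∀ K, 0 < ∑ o ∈ O K, a K o) (hbpos : ∀ K, 0 < ∑ o ∈ O K, b K o)
    (hkbarA : ∀ (K : ℕ) (t : ℝ), |t| ≤ l₀ → ∀ τ ∈ T K, 0 ≤ kbarA K t τ)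
    (hkA : ∀ (K : ℕ) (t : ℝ), |t| ≤ l₀ → ∀ τ ∈ T K, ∀ o ∈ O K,
      Real.exp (-σA K) * kbarA K t τ ≤ kA K t o τ ∧ kA K t o τ ≤ Real.exp (σA K) * kbarA K t τ)
    (hkB : ∀ (K : ℕ) (t : ℝ), |t| ≤ l₀ → ∀ τ ∈ T K, ∀ o ∈ O K,
      Real.exp (-σB K) * kbarB K t τ ≤ kB K t o τ ∧ kB K t o τ ≤ Real.exp (σB K) * kbarB K t τ)
    (hyoung : Core l₀ vol T Bad kbarA kbarB r) :
    Core l₀ vol T Bad (fun K t τ => ∑ o ∈ O K, a K o * kA K t o τ) (fun K t τ => ∑ o ∈ O K, b K o * kB K t o τ)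
      (fun K => r K + (σA K + σB K) / vol) :=
  core_fibreSum_of_factorisation (p := fun K t x => a K x.2 * kA K t x.2 x.1) (q := fun K t x => b K x.2 * kB K t x.2 x.1) hvol
    (factorisation_of_forwardKernel ha hkA) (factorisation_of_forwardKernel hb hkB) hkbarA hb hapos hbpos hyoung
end Kernel

/-! ## §2 The datum at the FULL key: law-separated, dead under every dial [folklore] -/
section Datum
variable {κ u η : ℕ → ℝ}

/-- Run A of the datum summed over the full index `Bool × Bool`: `2 + κ_K·(2 + η_K)`. [folklore] -/
theorem sum_full_p (K : ℕ) :
    ∑ x ∈ (Finset.univ : Finset (Bool × Bool)), (if x.1 then κ K else (1 : ℝ)) * (if x.1 && x.2 then 1 + η K else 1)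
      = 2 + κ K * (2 + η K) := by
  simp only [Fintype.sum_prod_type, Fintype.sum_bool, Bool.true_and, Bool.false_and, if_true, Bool.false_eq_true, if_false]
  ring

/-- Run B of the datum summed over the full index: `4 + κ_K e^{u_K}·(4 + 3η_K)`. [folklore] -/
theorem sum_full_q (K : ℕ) :
    ∑ x ∈ (Finset.univ : Finset (Bool × Bool)),
        (if x.2 then (3 : ℝ) else 1) * (if x.1 then κ K * Real.exp (u K) else 1) * (if x.1 && x.2 then 1 + η K else 1)
      = 4 + κ K * Real.exp (u K) * (4 + 3 * η K) := by
  simp only [Fintype.sum_prod_type, Fintype.sum_bool, Bool.true_and, Bool.false_and, if_true, Bool.false_eq_true, if_false]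
  ring

/-- Run A's mass of the OLD-LARGE-FIELD class `S = {o = true}`: `1 + κ_K(1 + η_K)`. [folklore] -/
theorem sum_old_p (K : ℕ) :
    ∑ x ∈ (Finset.univ : Finset (Bool × Bool)).filter (fun x => x.2 = true), (if x.1 then κ K else (1 : ℝ)) * (if x.1 && x.2 then 1 + η K else 1)
      = 1 + κ K * (1 + η K) := by
  have hS : (Finset.univ : Finset (Bool × Bool)).filter (fun x => x.2 = true) = {(false, true), (true, true)} := by decide
  rw [hS, Finset.sum_pair (by decide)]
  simp only [Bool.true_and, Bool.false_and, if_true, Bool.false_eq_true, if_false]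
  ring

/-- Run B's mass of the old-large-field class: `3 + 3κ_K e^{u_K}(1 + η_K)`. [folklore] -/
theorem sum_old_q (K : ℕ) :
    ∑ x ∈ (Finset.univ : Finset (Bool × Bool)).filter (fun x => x.2 = true),
        (if x.2 then (3 : ℝ) else 1) * (if x.1 then κ K * Real.exp (u K) else 1) * (if x.1 && x.2 then 1 + η K else 1)
      = 3 + 3 * (κ K * Real.exp (u K)) * (1 + η K) := by
  have hS : (Finset.univ : Finset (Bool × Bool)).filter (fun x => x.2 = true) = {(false, true), (true, true)} := by decide
  rw [hS, Finset.sum_pair (by decide)]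
  simp only [Bool.true_and, Bool.false_and, if_true, Bool.false_eq_true, if_false]
  ring

/-- **★ LAW SEPARATION AT THE FULL KEY** [folklore].  With `κ_K > 0`, `0 ≤ η_K ≤ 1` (any `u_K`): the old-large-field class has run-A law `(1 + κ(1+η))∕(2 + κ(2+η)) ≤ 2∕3` and run-B law
`3(1 + κe^u(1+η))∕(4 + κe^u(4+3η)) ≥ 3∕4`, so the two across-class laws are separated by `s = 1∕12` at EVERY level — the hypothesis `hsep` of dag-n19-w4's `no_dial_rescues`, in
its literal shape (cofinally in `K`, some `|t| ≤ l₀`, some `S ⊆ T K`). -/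
theorem lawSeparated_full {l₀ : ℝ} (hl₀ : 0 ≤ l₀) (hκ : ∀ K, 0 < κ K) (hη0 : ∀ K, 0 ≤ η K) (hη1 : ∀ K, η K ≤ 1) :
    ∀ K₀ : ℕ, ∃ K, K₀ ≤ K ∧ ∃ t : ℝ, |t| ≤ l₀ ∧ ∃ S, S ⊆ (Finset.univ : Finset (Bool × Bool)) ∧
      (1 : ℝ) / 12 ≤
        (∑ x ∈ S, (fun (K : ℕ) (_ : ℝ) (x : Bool × Bool) =>
            (if x.2 then (3 : ℝ) else 1) * (if x.1 then κ K * Real.exp (u K) else 1) * (if x.1 && x.2 then 1 + η K else 1)) K t x) /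
          (∑ x ∈ (Finset.univ : Finset (Bool × Bool)), (fun (K : ℕ) (_ : ℝ) (x : Bool × Bool) =>
            (if x.2 then (3 : ℝ) else 1) * (if x.1 then κ K * Real.exp (u K) else 1) * (if x.1 && x.2 then 1 + η K else 1)) K t x) -
        (∑ x ∈ S, (fun (K : ℕ) (_ : ℝ) (x : Bool × Bool) => (if x.1 then κ K else (1 : ℝ)) * (if x.1 && x.2 then 1 + η K else 1)) K t x) /
          (∑ x ∈ (Finset.univ : Finset (Bool × Bool)), (fun (K : ℕ) (_ : ℝ) (x : Bool × Bool) =>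
            (if x.1 then κ K else (1 : ℝ)) * (if x.1 && x.2 then 1 + η K else 1)) K t x) := by
  intro K₀
  refine ⟨K₀, le_rfl, 0, by simpa using hl₀, (Finset.univ : Finset (Bool × Bool)).filter (fun x => x.2 = true), Finset.filter_subset _ _, ?_⟩
  simp only [sum_full_p, sum_full_q, sum_old_p, sum_old_q]
  set k := κ K₀
  set e := η K₀
  set X := κ K₀ * Real.exp (u K₀) with hX
  have hk : 0 < k := hκ K₀
  have he0 : 0 ≤ e := hη0 K₀
  have he1 : e ≤ 1 := hη1 K₀
  have hXpos : 0 < X := mul_pos (hκ K₀) (Real.exp_pos _)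
  have hA : (1 + k * (1 + e)) / (2 + k * (2 + e)) ≤ 2 / 3 := by
    rw [div_le_div_iff₀ (by positivity) (by norm_num)]
    nlinarith [mul_nonneg hk.le he0, mul_le_mul_of_nonneg_left he1 hk.le]
  have hB : (3 : ℝ) / 4 ≤ (3 + 3 * X * (1 + e)) / (4 + X * (4 + 3 * e)) := by
    rw [div_le_div_iff₀ (by norm_num) (by positivity)]
    nlinarith [mul_nonneg hXpos.le he0]
  linarith

/-- **★★ THE FULL KEY IS DEAD UNDER EVERY DIAL** [folklore].  For the datum (`κ_K > 0`, `0 ≤ η_K ≤ 1`, any `u`), at the full key `T K = Bool × Bool`, for every `l₀ ≥ 0` and every `vol`: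
NO bad class `Bad`, weight `W`, shells `shA, shB`, shell weight `Wsh` and rate `δ` give `RelWeightBound ∧ ShellWeightBound ∧ (Core (p − shA) (q − shB) δ ∧ Summable δ)` — the v5
stub-2 face triple is unservable there WHATEVER the dials (dag-n19-w4's `no_dial_rescues` BY NAME, separation `1∕12` from `lawSeparated_full`). -/
theorem full_key_no_dial {l₀ : ℝ} (vol : ℝ) (hl₀ : 0 ≤ l₀) (hκ : ∀ K, 0 < κ K) (hη0 : ∀ K, 0 ≤ η K) (hη1 : ∀ K, η K ≤ 1) :
    ¬ ∃ (Bad : ℕ → ℝ → Finset (Bool × Bool)) (W : ℕ → ℝ) (shA shB : ℕ → ℝ → Bool × Bool → ℝ) (Wsh δ : ℕ → ℝ),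
      RelWeightBound l₀ (fun _ => (Finset.univ : Finset (Bool × Bool)))
        (fun K _ x => (if x.1 then κ K else (1 : ℝ)) * (if x.1 && x.2 then 1 + η K else 1))
        (fun K _ x => (if x.2 then (3 : ℝ) else 1) * (if x.1 then κ K * Real.exp (u K) else 1) * (if x.1 && x.2 then 1 + η K else 1)) Bad W ∧
      ShellWeightBound l₀ (fun _ => (Finset.univ : Finset (Bool × Bool)))
        (fun K _ x => (if x.1 then κ K else (1 : ℝ)) * (if x.1 && x.2 then 1 + η K else 1))
        (fun K _ x => (if x.2 then (3 : ℝ) else 1) * (if x.1 then κ K * Real.exp (u K) else 1) * (if x.1 && x.2 then 1 + η K else 1)) shA shB Wsh ∧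
      (Core l₀ vol (fun _ => (Finset.univ : Finset (Bool × Bool))) Bad
        (fun K t x => (fun (K : ℕ) (_ : ℝ) (x : Bool × Bool) => (if x.1 then κ K else (1 : ℝ)) * (if x.1 && x.2 then 1 + η K else 1)) K t x - shA K t x)
        (fun K t x => (fun (K : ℕ) (_ : ℝ) (x : Bool × Bool) =>
          (if x.2 then (3 : ℝ) else 1) * (if x.1 then κ K * Real.exp (u K) else 1) * (if x.1 && x.2 then 1 + η K else 1)) K t x - shB K t x) δ ∧
        Summable δ) :=
  no_dial_rescues (by norm_num : (0 : ℝ) < 1 / 12) (lawSeparated_full hl₀ hκ hη0 hη1) fun K t _ => by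
    show (0 : ℝ) < ∑ x ∈ (Finset.univ : Finset (Bool × Bool)), (if x.1 then κ K else (1 : ℝ)) * (if x.1 && x.2 then 1 + η K else 1)
    rw [sum_full_p]
    have := hκ K; have := hη0 K
    positivity

/-! ## §3 The SAME datum at the WINDOW key: alive, no dial [folklore] -/
/-- Run A factorises at the window key: class factor `k̄(y) = (κ_K ∣ 1)`, profile `≡ 1` (the SATURATED old law), LR error `log(1 + η_K)`. [folklore] -/
theorem fac_window_p {l₀ : ℝ} (hκ : ∀ K, 0 < κ K) (hη0 : ∀ K, 0 ≤ η K) :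
    ∀ (K : ℕ) (t : ℝ), |t| ≤ l₀ → ∀ y ∈ (Finset.univ : Finset Bool), ∀ o ∈ (Finset.univ : Finset Bool),
      Real.exp (-Real.log (1 + η K)) * ((if y then κ K else (1 : ℝ)) * (1 : ℝ)) ≤
          (if y then κ K else (1 : ℝ)) * (if y && o then 1 + η K else 1) ∧
        (if y then κ K else (1 : ℝ)) * (if y && o then 1 + η K else 1) ≤
          Real.exp (Real.log (1 + η K)) * ((if y then κ K else (1 : ℝ)) * (1 : ℝ)) := by
  intro K t _ y _ o _
  have hη := hη0 K
  have h1 : 0 < 1 + η K := by linarith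
  rw [Real.exp_neg, Real.exp_log h1, mul_one]
  have hm : 0 ≤ (if y then κ K else (1 : ℝ)) := by split_ifs <;> [exact (hκ K).le; exact zero_le_one]
  have hf1 : (if y && o then 1 + η K else (1 : ℝ)) ≤ 1 + η K := by split_ifs <;> linarith
  have hf2 : (1 + η K)⁻¹ ≤ (if y && o then 1 + η K else (1 : ℝ)) := by
    have : (1 + η K)⁻¹ ≤ 1 := inv_le_one_of_one_le₀ (by linarith)
    split_ifs <;> linarith
  constructor
  · calc (1 + η K)⁻¹ * (if y then κ K else (1 : ℝ)) = (if y then κ K else (1 : ℝ)) * (1 + η K)⁻¹ := mul_comm _ _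
      _ ≤ (if y then κ K else (1 : ℝ)) * (if y && o then 1 + η K else 1) := mul_le_mul_of_nonneg_left hf2 hm
  · calc (if y then κ K else (1 : ℝ)) * (if y && o then 1 + η K else 1) ≤ (if y then κ K else (1 : ℝ)) * (1 + η K) := mul_le_mul_of_nonneg_left hf1 hm
      _ = (1 + η K) * ((if y then κ K else (1 : ℝ))) := mul_comm _ _

/-- Run B factorises at the window key: class factor `k̄′(y) = (κ_K e^{u_K} ∣ 1)`, profile `b(o) = (3 ∣ 1)` — the old block MISMATCHED against run A by the factor `3` — LR error `log(1 + η_K)`.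
[folklore] -/
theorem fac_window_q {l₀ : ℝ} (hκ : ∀ K, 0 < κ K) (hη0 : ∀ K, 0 ≤ η K) :
    ∀ (K : ℕ) (t : ℝ), |t| ≤ l₀ → ∀ y ∈ (Finset.univ : Finset Bool), ∀ o ∈ (Finset.univ : Finset Bool),
      Real.exp (-Real.log (1 + η K)) * ((if y then κ K * Real.exp (u K) else (1 : ℝ)) * (if o then (3 : ℝ) else 1)) ≤
          (if o then (3 : ℝ) else 1) * (if y then κ K * Real.exp (u K) else 1) * (if y && o then 1 + η K else 1) ∧
        (if o then (3 : ℝ) else 1) * (if y then κ K * Real.exp (u K) else 1) * (if y && o then 1 + η K else 1) ≤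
          Real.exp (Real.log (1 + η K)) * ((if y then κ K * Real.exp (u K) else (1 : ℝ)) * (if o then (3 : ℝ) else 1)) := by
  intro K t _ y _ o _
  have hη := hη0 K
  have h1 : 0 < 1 + η K := by linarith
  rw [Real.exp_neg, Real.exp_log h1]
  have hm : 0 ≤ (if y then κ K * Real.exp (u K) else (1 : ℝ)) * (if o then (3 : ℝ) else 1) := by
    apply mul_nonneg
    · split_ifs <;> [exact (mul_pos (hκ K) (Real.exp_pos _)).le; exact zero_le_one]
    · split_ifs <;> norm_num
  have hf1 : (if y && o then 1 + η K else (1 : ℝ)) ≤ 1 + η K := by split_ifs <;> linarith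
  have hf2 : (1 + η K)⁻¹ ≤ (if y && o then 1 + η K else (1 : ℝ)) := by
    have : (1 + η K)⁻¹ ≤ 1 := inv_le_one_of_one_le₀ (by linarith)
    split_ifs <;> linarith
  have hre : (if o then (3 : ℝ) else 1) * (if y then κ K * Real.exp (u K) else 1) * (if y && o then 1 + η K else 1)
      = ((if y then κ K * Real.exp (u K) else (1 : ℝ)) * (if o then (3 : ℝ) else 1)) * (if y && o then 1 + η K else 1) := by ring
  rw [hre]
  constructor
  · rw [mul_comm ((1 + η K)⁻¹)]
    exact mul_le_mul_of_nonneg_left hf2 hm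
  · rw [mul_comm (1 + η K)]
    exact mul_le_mul_of_nonneg_left hf1 hm

/-- The YOUNG class factors match modulo constants at radius `u_K` (`u ≥ 0`, `0 < vol`): `Core l₀ vol {false,true} ∅ k̄ k̄′ (K ↦ u_K∕vol)` with constant `0`. [folklore] -/
theorem core_youngFactors {l₀ vol : ℝ} (hvol : 0 < vol) (hκ : ∀ K, 0 < κ K) (hu : ∀ K, 0 ≤ u K) :
    Core l₀ vol (fun _ => (Finset.univ : Finset Bool)) (fun _ _ => (∅ : Finset Bool))
      (fun K _ y => if y then κ K else (1 : ℝ)) (fun K _ y => if y then κ K * Real.exp (u K) else (1 : ℝ)) (fun K => u K / vol) := by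
  intro K
  refine ⟨0, fun t _ y _ => ?_⟩
  have hr : vol * (u K / vol) = u K := mul_div_cancel₀ _ hvol.ne'
  rw [hr, zero_sub, zero_add]
  have hu0 := hu K
  have hk := hκ K
  cases y
  · simp only [Bool.false_eq_true, if_false, mul_one]
    exact ⟨Real.exp_le_one_iff.mpr (by linarith), Real.one_le_exp (by linarith)⟩
  · simp only [if_true]
    constructor
    · rw [mul_comm]
      exact mul_le_mul_of_nonneg_left (Real.exp_le_exp.mpr (by linarith)) hk.le
    · rw [mul_comm]

/-- **★★★ THE WINDOW KEY IS ALIVE WITH NO DIAL** [folklore].  For the SAME datum (`κ_K > 0`, `u_K ≥ 0`, `η_K ≥ 0`, `0 < vol`, any `l₀`), summing out the old block: the young classes' fibre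
sums match modulo constants with EMPTY bad class at radius `(u_K + 2·log(1 + η_K))∕vol` — p610409's `core_fibreSum_of_factorisation` BY NAME; the old mismatch factor `3` and the
saturated old law are absorbed into the constant `c_K = log 2`. -/
theorem window_key_core {l₀ vol : ℝ} (hvol : 0 < vol) (hκ : ∀ K, 0 < κ K) (hu : ∀ K, 0 ≤ u K) (hη0 : ∀ K, 0 ≤ η K) :
    Core l₀ vol (fun _ => (Finset.univ : Finset Bool)) (fun _ _ => (∅ : Finset Bool))
      (fun K _ y => ∑ o ∈ (Finset.univ : Finset Bool), (if y then κ K else (1 : ℝ)) * (if y && o then 1 + η K else 1))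
      (fun K _ y => ∑ o ∈ (Finset.univ : Finset Bool),
        (if o then (3 : ℝ) else 1) * (if y then κ K * Real.exp (u K) else 1) * (if y && o then 1 + η K else 1))
      (fun K => u K / vol + (Real.log (1 + η K) + Real.log (1 + η K)) / vol) :=
  core_fibreSum_of_factorisation (O := fun _ => (Finset.univ : Finset Bool)) (φA := fun _ _ => (1 : ℝ)) (φB := fun _ o => if o then (3 : ℝ) else 1)
    (p := fun K _ x => (if x.1 then κ K else (1 : ℝ)) * (if x.1 && x.2 then 1 + η K else 1))
    (q := fun K _ x => (if x.2 then (3 : ℝ) else 1) * (if x.1 then κ K * Real.exp (u K) else 1) * (if x.1 && x.2 then 1 + η K else 1))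
    hvol (fac_window_p hκ hη0) (fac_window_q hκ hη0)
    (fun K _ _ y _ => by split_ifs <;> [exact (hκ K).le; exact zero_le_one])
    (fun _ o _ => by split_ifs <;> norm_num) (fun _ => by simp)
    (fun _ => by simp only [Fintype.sum_bool, if_true, Bool.false_eq_true, if_false]; norm_num) (core_youngFactors hvol hκ hu)

/-- The window-key radius is summable as soon as the young discrepancy `u` and the old→young coupling `η` are (`log(1 + η) ≤ η`). [folklore] -/
theorem summable_windowRadius {vol : ℝ} (hu0 : ∀ K, 0 ≤ u K) (hu : Summable u) (hη0 : ∀ K, 0 ≤ η K) (hη : Summable η) :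
    Summable fun K => u K / vol + (Real.log (1 + η K) + Real.log (1 + η K)) / vol := by
  have hlog : Summable fun K => Real.log (1 + η K) := by
    refine Summable.of_nonneg_of_le (fun K => Real.log_nonneg (by linarith [hη0 K])) (fun K => ?_) hη
    have h := Real.log_le_sub_one_of_pos (show 0 < 1 + η K by linarith [hη0 K])
    linarith
  have _ := hu0
  exact (hu.div_const vol).add ((hlog.add hlog).div_const vol)

/-- **★★ THE FULL BINDER LIST AT THE WINDOW KEY, NO DIAL** [folklore].  Same datum, `u`, `η` non-negative and summable: `HybridNE7` at the window key with EMPTY bad class, ZERO weight,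
ZERO shells — `RelWeightBound` is the trivial empty-class datum, `Core` is `window_key_core` (p610409's `hybridNE7_fibreSum_of_factorisation` BY NAME).  Contrast §2: at the full key
no choice of the five dials serves even the face triple. -/
theorem window_key_hybridNE7 {l₀ vol : ℝ} (hvol : 0 < vol) (hκ : ∀ K, 0 < κ K) (hu0 : ∀ K, 0 ≤ u K) (hu : Summable u)
    (hη0 : ∀ K, 0 ≤ η K) (hη : Summable η) :
    HybridNE7 l₀ vol (fun _ => (Finset.univ : Finset Bool))
      (fun K _ y => ∑ o ∈ (Finset.univ : Finset Bool), (if y then κ K else (1 : ℝ)) * (if y && o then 1 + η K else 1))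
      (fun K _ y => ∑ o ∈ (Finset.univ : Finset Bool),
        (if o then (3 : ℝ) else 1) * (if y then κ K * Real.exp (u K) else 1) * (if y && o then 1 + η K else 1))
      (fun _ _ => (∅ : Finset Bool)) (fun _ => 0) (fun _ _ _ => 0) (fun _ _ _ => 0) (fun _ => 0)
      (fun K => u K / vol + (Real.log (1 + η K) + Real.log (1 + η K)) / vol) := by
  have hW : RelWeightBound l₀ (fun _ => (Finset.univ : Finset Bool))
      (fun K (_ : ℝ) y => ∑ o ∈ (Finset.univ : Finset Bool), (if y then κ K else (1 : ℝ)) * (if y && o then 1 + η K else 1))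
      (fun K (_ : ℝ) y => ∑ o ∈ (Finset.univ : Finset Bool),
        (if o then (3 : ℝ) else 1) * (if y then κ K * Real.exp (u K) else 1) * (if y && o then 1 + η K else 1))
      (fun _ _ => (∅ : Finset Bool)) (fun _ => 0) :=
    { bad_subset := fun _ _ _ => Finset.empty_subset _
      nonneg := fun _ => le_rfl
      lt_one := fun _ => zero_lt_one
      summable := summable_zero
      bad_left := fun _ _ _ => by simp
      bad_right := fun _ _ _ => by simp }
  refine hybridNE7_fibreSum_of_factorisation (O := fun _ => (Finset.univ : Finset Bool)) (φA := fun _ _ => (1 : ℝ)) (φB := fun _ o => if o then (3 : ℝ) else 1)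
    (p := fun K _ x => (if x.1 then κ K else (1 : ℝ)) * (if x.1 && x.2 then 1 + η K else 1))
    (q := fun K _ x => (if x.2 then (3 : ℝ) else 1) * (if x.1 then κ K * Real.exp (u K) else 1) * (if x.1 && x.2 then 1 + η K else 1))
    hvol (fac_window_p hκ hη0) (fac_window_q hκ hη0)
    (fun K _ _ y _ => by split_ifs <;> [exact (hκ K).le; exact zero_le_one])
    (fun _ o _ => by split_ifs <;> norm_num) (fun _ => by simp)
    (fun _ => by simp only [Fintype.sum_bool, if_true, Bool.false_eq_true, if_false]; norm_num) (core_youngFactors hvol hκ hu0)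
    (fun K _ _ y _ o _ => ?_) (fun K _ _ y _ o _ => ?_) hW (summable_windowRadius hu0 hu hη0 hη)
  · have := hκ K; have := hη0 K
    apply mul_nonneg <;> split_ifs <;> positivity
  · have := hκ K; have := hη0 K
    apply mul_nonneg
    · apply mul_nonneg <;> split_ifs <;> positivity
    · split_ifs <;> linarith

/-! ## §4 At the window key the coupling must be paid, and summably [folklore] -/
/-- The window-key class gap of the datum: `(log Σq − log Σp)(true) − (log Σq − log Σp)(false) = u_K + log((4 + 3η)∕(4 + 2η)) ≥ η_K∕7` for `0 ≤ η_K ≤ 1`, `u_K ≥ 0` (young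
discrepancy only widens it). [folklore] -/
theorem window_gap_ge {k v e : ℝ} (hk : 0 < k) (hv : 0 ≤ v) (he0 : 0 ≤ e) (he1 : e ≤ 1) :
    e / 7 ≤ (Real.log (k * Real.exp v * (1 + 3 * (1 + e))) - Real.log (k * (1 + (1 + e)))) - (Real.log (1 + 3) - Real.log (1 + 1)) := by
  have hA : 0 < k * (1 + (1 + e)) := by positivity
  have hB : 0 < k * Real.exp v * (1 + 3 * (1 + e)) := by positivity
  have h1 : Real.log (k * Real.exp v * (1 + 3 * (1 + e))) - Real.log (k * (1 + (1 + e))) = v + Real.log ((4 + 3 * e) / (2 + e)) := by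
    rw [← Real.log_div hB.ne' hA.ne', ← Real.log_exp v, ← Real.log_mul (Real.exp_pos v).ne' (by positivity)]
    congr 1
    rw [Real.log_exp]
    field_simp
    ring
  have h2 : Real.log (1 + 3) - Real.log (1 + 1) = Real.log 2 := by
    rw [← Real.log_div (by norm_num) (by norm_num)]; norm_num
  rw [h1, h2]
  -- `log((4+3e)/(2+e)) − log 2 = log((4+3e)/(4+2e)) ≥ 1 − (4+2e)/(4+3e) = e/(4+3e) ≥ e/7`
  have h3 : Real.log ((4 + 3 * e) / (2 + e)) - Real.log 2 = Real.log ((4 + 3 * e) / (4 + 2 * e)) := by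
    rw [← Real.log_div (by positivity) (by norm_num)]
    congr 1
    field_simp
    ring
  have h4 : e / 7 ≤ Real.log ((4 + 3 * e) / (4 + 2 * e)) := by
    have hx : 0 < (4 + 3 * e) / (4 + 2 * e) := by positivity
    have hlow := Real.one_sub_inv_le_log_of_pos hx
    have hinv : ((4 + 3 * e) / (4 + 2 * e))⁻¹ = (4 + 2 * e) / (4 + 3 * e) := by rw [inv_div]
    rw [hinv] at hlow
    have h5 : e / 7 ≤ 1 - (4 + 2 * e) / (4 + 3 * e) := by
      have hre : 1 - (4 + 2 * e) / (4 + 3 * e) = e / (4 + 3 * e) := by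
        field_simp
        ring
      rw [hre, div_le_div_iff₀ (by norm_num) (by positivity)]
      nlinarith
    linarith
  linarith

/-- **★★ NO SUMMABLE COUPLING, NO WINDOW-KEY `Core`** [folklore].  Same datum with `κ_K > 0`, `u_K ≥ 0`, `0 ≤ η_K ≤ 1` but `η` NOT summable: NO `δ` gives `Core … ∅ (Σ_o p) (Σ_o q) δ ∧
Summable δ` at the window key (class gap `≥ η_K∕7`, g3's `not_coreEdge_of_unsummable_gap` BY NAME).  With §3: in the caricature the old→young LR-coupling is EXACTLY what the window
key charges — absorbed old mismatch, saturated old class and all — and it must be summable in `K`. -/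
theorem window_key_needs_summable_coupling {l₀ vol : ℝ} (hl₀ : 0 ≤ l₀) (hκ : ∀ K, 0 < κ K) (hu : ∀ K, 0 ≤ u K)
    (hη0 : ∀ K, 0 ≤ η K) (hη1 : ∀ K, η K ≤ 1) (hη : ¬ Summable η) :
    ¬ ∃ δ : ℕ → ℝ, Core l₀ vol (fun _ => (Finset.univ : Finset Bool)) (fun _ _ => (∅ : Finset Bool))
        (fun K _ y => ∑ o ∈ (Finset.univ : Finset Bool), (if y then κ K else (1 : ℝ)) * (if y && o then 1 + η K else 1))
        (fun K _ y => ∑ o ∈ (Finset.univ : Finset Bool),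
          (if o then (3 : ℝ) else 1) * (if y then κ K * Real.exp (u K) else 1) * (if y && o then 1 + η K else 1)) δ ∧
      Summable δ := by
  refine not_coreEdge_of_unsummable_gap (g := fun K => η K / 7) (fun K => by have := hη0 K; positivity)
    (fun hs => hη ((hs.mul_left 7).congr fun K => by ring)) fun K => ?_
  refine ⟨0, by simpa using hl₀, true, by simp, false, by simp, ?_, ?_, ?_⟩
  · simp only [Fintype.sum_bool, Bool.true_and, if_true, Bool.false_eq_true, if_false]
    have := hκ K; have := hη0 K
    positivity
  · simp only [Fintype.sum_bool, Bool.false_and, Bool.false_eq_true, if_false]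
    norm_num
  · simp only [Fintype.sum_bool, Bool.true_and, Bool.false_and, if_true, Bool.false_eq_true, if_false, mul_one, one_mul]
    have h := window_gap_ge (hκ K) (hu K) (hη0 K) (hη1 K)
    convert h using 2 <;> ring_nf

end Datum
end Summit.QuantumFields.YangMills.BalabanUVNodes.N19OneDatumTwoKeys
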